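import Summits.BirchSwinnertonDyer.BirchSwinnertonDyer.Theorems.CMKolyvaginAtInertTwoCMKolyvaginConjectureAtInertTwoObstructionClassOrderAndSha
import Literature.NumberTheory.EllipticCurves.MordellWeilTheoremProofs
import HarnessLib

/-!
# Route `CMKolyvaginAtInertTwo`, crux `CMKolyvaginConjectureAtInertTwo` (stmt-BirchSwinnertonDyer-24648),
# stub `stub_positiveDepth` — THE `ε`-LINE FROM `rank E(K) = 1`, AND THE TRIVIAL-`Ш` REGIME WITHOUT DEEP
# PRIME-LEVEL WITNESSES

Seat `leafhand-bsd-cmkolyvaginatinert-6` g0 (cell `bsd-eis`); helper `--supports stmt-BirchSwinnertonDyer-24648`.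
THEOREMS ONLY: no definition, no named fact, no `sorry`.  BSD is NOT proved by any of this; the stub and the crux
stay OPEN.  Sequel of `…ObstructionClassOrderAndSha` (this seat): there, §3 took the `ε`-LINE of `E(K)`
(`τ x − ε x` torsion for all `x ∈ E(K)`, `ε = −w(E)`) as a hypothesis.  Here:

* `exists_generator_of_mordellWeilRank_eq_one` — `rank E(K) = 1 ⟹ E(K) = ℤ g + torsion` (a Mordell–Weil basis of the
  rank-one group, the tree's `exists_isMordellWeilBasis_holds`; Mordell–Weil is proved in the tree);
* `isOfFinAddOrder_map_sub_smul_of_mordellWeilRank_eq_one` — **the `ε`-line from `rank E(K) = 1` and a `K`-rational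
  Heegner point of infinite order** (Gross Prop. 5.3 on the Mordell–Weil line); on H₂ both are the
  Gross–Zagier–Kolyvagin theorem for `(E, K)` — inputs of the route (`mordellWeilRank_eq_one_of_LDerivEK_ne_zero`,
  bsd.S16), not proved here;
* `pow_zsmul_torsionH1ToH1_obstructionClass_ne_zero` — **`Ш(E/K)` has an element of order `≥ 2^{M₀−m(ℓ)−1}`**
  (`2^{M₀−j−1} ∤ P(ℓ) ⟹ 2^j·š_ℓ ≠ 0`): McCallum's «`d_{M₀}(ℓ) ∈ Ш` of order `p^{M₀−M₁}`» at `p = 2`, one bit lost;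
* `two_zsmul_obstructionClass_eq_zero_of_sha_eq_bot` — on a trivial-`Ш` frame EVERY obstruction class `s_ℓ` (any
  Zhang–Kolyvagin `ℓ` of index `≥ L ≥ M₀`, any datum) is `2`-torsion (class form of the one-bit theorem);
* `pow_dvd_derivedPoint_of_sha_eq_bot_of_mordellWeilRank_eq_one` — the trivial-`Ш` one-bit theorem of the predecessor
  with these inputs in place of the `ε`-line;
* `two_dvd_derivedPoint_of_sha_eq_bot_of_two_le` — **on a frame with `Ш(E/K)[2^∞] = ⊥` and `2^{M₀} ∣ y_K`, `M₀ ≥ 2`,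
  every Zhang–Kolyvagin prime `ℓ` at `2` of index `≥ L ≥ M₀` and every datum have `P(ℓ) ∈ 2E(K[ℓ])`**: a witness
  `(n, d)` of the crux on such a frame is composite or shallow (index `< M₀`).  Reading for the LINE-15 split
  (R0 `CMHeegnerTwoPrimitiveOfTrivialShaTwo` / R1): in the R0 regime the deep prime-level form of Kolyvagin's
  conjecture at `2` forces `M₀ ≤ 1`, one bit short of R0's `M₀ = 0`.

References: [McCallumLMS1991] §5 (Prop. 5.2, Thm. 5.4); [GrossLMS1991] §5 (5.1), Prop. 5.3; [SilvermanAEC2009] VIII.6.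
-/

set_option autoImplicit false
-- the Theorems namespace of this sub repeats the summit name by design (D-0017 nested layout)
set_option linter.dupNamespace false

noncomputable section

open scoped Classical

open Field NumberField IsDedekindDomain Function WeierstrassCurve
open Literature.NumberTheory.EllipticCurves
open Literature.NumberTheory.EllipticCurves.ModularForms
open Literature.NumberTheory.GaloisRepresentations
open Literature.NumberTheory.GaloisCohomology
open Literature.NumberTheory.EllipticCurves.GrossLMS1991 (prop37_2_reductionCongruence_inert)

namespace Summit.BirchSwinnertonDyer.BirchSwinnertonDyer.Theorems.CMKolyvaginFirstDescentTwo

variable (W : WeierstrassCurve ℚ) [W.IsElliptic] [W.IsGloballyMinimal] [NeZero (W.conductorNorm ℤ)]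
  {K : Type} [Field K] [NumberField K]

/-! ## The `ε`-line from `rank E(K) = 1`, and the trivial-`Ш` regime -/

omit [W.IsGloballyMinimal] [NeZero (W.conductorNorm ℤ)] in
/-- **`rank E(K) = 1 ⟹ E(K) = ℤ g + torsion`**: a Mordell–Weil basis of the rank-one group `E(K)` (the tree's
`exists_isMordellWeilBasis_holds`, Mordell–Weil proved) is a single point `g`, and every `x ∈ E(K)` is `c g + t` with
`t` torsion.  (Adapted from the tree's `exists_int_canonicalHeight_eq_sq_mul_regulator`.) [cite: SilvermanAEC2009, VIII.6] -/
theorem exists_generator_of_mordellWeilRank_eq_one (hr : (W.baseChange K).mordellWeilRank = 1) :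
    ∃ g : (W.baseChange K).toAffine.Point, ∀ x : (W.baseChange K).toAffine.Point, ∃ c : ℤ, IsOfFinAddOrder (x - c • g) := by
  haveI : (W.baseChange K).IsElliptic := by rw [baseChange]; infer_instance
  obtain ⟨B, hB⟩ := (W.baseChange K).exists_isMordellWeilBasis_holds
  generalize hr' : (W.baseChange K).mordellWeilRank = r at B hB
  rw [hr] at hr'
  subst hr'
  refine ⟨B 0, fun x ↦ ?_⟩
  have hmem : (QuotientAddGroup.mk x : mordellWeilModTorsion (W.baseChange K)) ∈
      Submodule.span ℤ (Set.range (QuotientAddGroup.mk ∘ B : Fin 1 → mordellWeilModTorsion (W.baseChange K))) := by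
    rw [hB.2]; exact Submodule.mem_top
  obtain ⟨c, hc⟩ := (Submodule.mem_span_range_iff_exists_fun ℤ).mp hmem
  rw [Fin.sum_univ_one] at hc
  refine ⟨c 0, ?_⟩
  rw [← AddCommGroup.mem_torsion, ← QuotientAddGroup.eq_zero_iff, QuotientAddGroup.mk_sub,
    QuotientAddGroup.mk_zsmul, sub_eq_zero]
  exact hc.symm

/-- **The `ε`-line from `rank E(K) = 1` and a `K`-rational Heegner point of infinite order** (`K` imaginary quadratic
and Heegner for `N_W`, `τ ≠ 1`): `τ x − (−w(E)) x` is torsion for every `x ∈ E(K)` (Gross Prop. 5.3 on the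
Mordell–Weil line).  On H₂ both inputs are the Gross–Zagier–Kolyvagin theorem for `(E, K)`.
[cite: GrossLMS1991, §5 Prop. 5.3] [cite: SilvermanAEC2009, VIII.6] -/
theorem isOfFinAddOrder_map_sub_smul_of_mordellWeilRank_eq_one (hK : IsImaginaryQuadratic K)
    (hHe : SatisfiesHeegnerHypothesis (W.conductorNorm ℤ) K) (τ : K ≃ₐ[ℚ] K) (hτ : τ ≠ 1)
    (hr : (W.baseChange K).mordellWeilRank = 1)
    {Ph : (W.baseChange K).toAffine.Point} (hPh : IsHeegnerPoint (W.conductorNorm ℤ) W K Ph)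
    (hnt : ¬ IsOfFinAddOrder Ph) (x : (W.baseChange K).toAffine.Point) :
    IsOfFinAddOrder (Affine.Point.map (W' := W) (τ : K →ₐ[ℚ] K) x - (-W.rootNumber) • x) := by
  obtain ⟨g, hgT⟩ := exists_generator_of_mordellWeilRank_eq_one W hr
  exact isOfFinAddOrder_map_sub_smul_of_generator W hK hHe τ hτ hPh hnt g hgT x

/-- **`Ш(E/K)` contains an element of order `≥ 2^{M₀−m(ℓ)−1}`** (McCallum's "`d_{M₀}(ℓ) ∈ Ш` of order `p^{M₀−M₁}`" at
`p = 2`, one bit lost): frame of file #1 §3 with the `ε`-line, a conductor-`1` datum with `2^{M₀} ∣ y_K`, `M₀ ≤ L`;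
`ℓ` Zhang–Kolyvagin at `2` of index `≥ L`, `e` any datum, `j + 1 ≤ M₀` with **`2^{M₀−j−1} ∤ P(ℓ)`**; then
`2^j·š_ℓ ≠ 0` for the image `š_ℓ ∈ Ш(E/K)` of `s_ℓ` (apply the sign clash to the obstruction class `2^j·s_ℓ` of depth
`M₀ − j`). [cite: McCallumLMS1991, §5 (the class d, before Prop. 5.2)] [cite: GrossLMS1991, §5 (5.1), Prop. 5.3] -/
theorem pow_zsmul_torsionH1ToH1_obstructionClass_ne_zero (hρ2 : W.HasSurjectiveModNGaloisRep 2)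
    (hK : IsImaginaryQuadratic K) (hodd : Odd (NumberField.discr K)) (h3 : NumberField.discr K ≠ -3)
    (hHe : SatisfiesHeegnerHypothesis (W.conductorNorm ℤ) K) (τ : K ≃ₐ[ℚ] K) (hτ : τ ≠ 1)
    (hline : ∀ x : (W.baseChange K).toAffine.Point,
      IsOfFinAddOrder (Affine.Point.map (W' := W) (τ : K →ₐ[ℚ] K) x - (-W.rootNumber) • x))
    (Dt : ModularParametrizationData W (W.conductorNorm ℤ)) (β : ℤ) (ι : K →+* ℂ)
    (d₁ : KolyvaginHeegnerData Dt β ι 1) {M₀ L j : ℕ} (hj : j + 1 ≤ M₀) (hML : M₀ ≤ L)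
    {ℓ : ℕ} (hKol : Zhang2014.IsKolyvaginPrime (W.conductorNorm ℤ) W K 2 ℓ)
    (hidx : L ≤ Zhang2014.kolyvaginIndex W 2 ℓ) (e : KolyvaginHeegnerData Dt β ι ℓ)
    (hnd : ¬ ∃ Q : (W.baseChange (ringClassField K ι ℓ)).toAffine.Point,
      ((2 ^ (M₀ - j - 1) : ℕ) : ℤ) • Q = e.derivedPoint) :
    ((2 ^ j : ℕ) : ℤ) • torsionH1ToH1 (W.baseChange K) ((2 ^ L : ℕ) : ℤ)
        (((2 ^ (L - M₀) : ℕ) : ℤ) • e.kolyvaginClass Nat.prime_two L) ≠ 0 := by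
  have hL : 1 ≤ L := by omega
  -- `2^j · s_ℓ` is the obstruction class of depth `M₀ − j`
  have hcls : ((2 ^ j : ℕ) : ℤ) • (((2 ^ (L - M₀) : ℕ) : ℤ) • e.kolyvaginClass Nat.prime_two L) =
      ((2 ^ (L - (M₀ - j)) : ℕ) : ℤ) • e.kolyvaginClass Nat.prime_two L := by
    rw [smul_smul, ← Nat.cast_mul, ← pow_add, show j + (L - M₀) = L - (M₀ - j) by omega]
  intro h
  rw [← map_zsmul, hcls] at h
  -- sign clash at depth `M₀ − j`: `2 · (2^j · s_ℓ) = 0`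
  have h2 := two_zsmul_obstructionClass_eq_zero_of_torsionH1ToH1_eq_zero W hρ2 hK hodd h3 hHe τ hτ hline Dt β ι
    (M₀ := M₀ - j) hL hKol hidx e h
  -- i.e. `2^{(M₀−j)−1} ∣ P(ℓ)` by the ladder at depth `M₀ − j`
  have h1 : 1 ≤ M₀ - j := by omega
  exact hnd ((pow_zsmul_obstructionClass_eq_zero_iff W hρ2 hK hodd h3 hHe Dt β ι d₁ h1 (by omega : M₀ - j ≤ L) hKol
    hidx e).mp (by rw [pow_one, Nat.cast_ofNat]; exact h2))

/-- **On a trivial-`Ш` frame every obstruction class is `2`-torsion**: frame of file #1 §3 (`ρ̄_{E,2}` onto, odd Tamagawa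
product; `K` imaginary quadratic, odd `d_K ≠ −3`, Heegner, `τ ≠ 1`; Gross Prop. 3.7 (2) by name; the `ε`-line),
`Ш(E/K)[2^∞] = ⊥`, a conductor-`1` datum with `2^{M₀} ∣ y_K`, `M₀ ≤ L`, `1 ≤ L`; then `2·s_ℓ = 0` for every Zhang–Kolyvagin
prime `ℓ` at `2` of index `≥ L` and every datum of conductor `ℓ` (the image `š_ℓ` lies in `Ш(E/K)[2^{M₀}] = 0`, then the
sign clash). [cite: McCallumLMS1991, §5 (the class d)] [cite: GrossLMS1991, §5 (5.1), Prop. 5.3] -/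
theorem two_zsmul_obstructionClass_eq_zero_of_sha_eq_bot (hρ2 : W.HasSurjectiveModNGaloisRep 2)
    (hT : Odd W.tamagawaProduct)
    (hK : IsImaginaryQuadratic K) (hodd : Odd (NumberField.discr K)) (h3 : NumberField.discr K ≠ -3)
    (hHe : SatisfiesHeegnerHypothesis (W.conductorNorm ℤ) K)
    (h37 : prop37_2_reductionCongruence_inert (W.conductorNorm ℤ) W K) (τ : K ≃ₐ[ℚ] K) (hτ : τ ≠ 1)
    (hline : ∀ x : (W.baseChange K).toAffine.Point,
      IsOfFinAddOrder (Affine.Point.map (W' := W) (τ : K →ₐ[ℚ] K) x - (-W.rootNumber) • x))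
    (hSha : AddCommGroup.primaryComponent (W.baseChange K).sha 2 = ⊥)
    (Dt : ModularParametrizationData W (W.conductorNorm ℤ)) (β : ℤ) (ι : K →+* ℂ)
    (d₁ : KolyvaginHeegnerData Dt β ι 1) {M₀ L : ℕ} (hL : 1 ≤ L) (hML : M₀ ≤ L)
    (hdiv : ∃ Q : (W.baseChange (ringClassField K ι 1)).toAffine.Point,
      ((2 ^ M₀ : ℕ) : ℤ) • Q = d₁.derivedPoint)
    {ℓ : ℕ} (hKol : Zhang2014.IsKolyvaginPrime (W.conductorNorm ℤ) W K 2 ℓ)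
    (hidx : L ≤ Zhang2014.kolyvaginIndex W 2 ℓ) (e : KolyvaginHeegnerData Dt β ι ℓ) :
    (2 : ℤ) • (((2 ^ (L - M₀) : ℕ) : ℤ) • e.kolyvaginClass Nat.prime_two L) = 0 := by
  obtain ⟨hsha, hkill⟩ :=
    torsionH1ToH1_obstructionClass_mem_sha W hρ2 hT hK hodd h3 hHe h37 Dt β ι d₁ hML hdiv hKol hidx e
  have hmem : (⟨_, hsha⟩ : (W.baseChange K).sha) ∈ AddCommGroup.primaryComponent (W.baseChange K).sha 2 := by
    rw [AddCommGroup.mem_primaryComponent]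
    refine ⟨M₀, Subtype.ext ?_⟩
    rw [AddSubgroup.coe_nsmul, AddSubgroup.coe_zero, ← natCast_zsmul]
    exact hkill
  rw [hSha, AddSubgroup.mem_bot] at hmem
  exact two_zsmul_obstructionClass_eq_zero_of_torsionH1ToH1_eq_zero W hρ2 hK hodd h3 hHe τ hτ hline Dt β ι hL
    hKol hidx e (congrArg Subtype.val hmem)

/-- **R0 regime with the rank-one input in place of the `ε`-line.**  Frame as in
`pow_dvd_derivedPoint_of_sha_primaryComponent_eq_bot`, with `rank E(K) = 1` and a `K`-rational Heegner point of
infinite order instead of the `ε`-line: `Ш(E/K)[2^∞] = ⊥`, `2^{M₀} ∣ y_K`, `1 ≤ M₀ ≤ L` ⟹ every Zhang–Kolyvagin prime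
of index `≥ L` and every datum keep `2^{M₀−1} ∣ P(ℓ)`. [cite: McCallumLMS1991, §5 (Prop. 5.2, Thm. 5.4)]
[cite: GrossLMS1991, §5 (5.1), Prop. 5.3] -/
theorem pow_dvd_derivedPoint_of_sha_eq_bot_of_mordellWeilRank_eq_one (hρ2 : W.HasSurjectiveModNGaloisRep 2)
    (hT : Odd W.tamagawaProduct)
    (hK : IsImaginaryQuadratic K) (hodd : Odd (NumberField.discr K)) (h3 : NumberField.discr K ≠ -3)
    (hHe : SatisfiesHeegnerHypothesis (W.conductorNorm ℤ) K)
    (h37 : prop37_2_reductionCongruence_inert (W.conductorNorm ℤ) W K) (τ : K ≃ₐ[ℚ] K) (hτ : τ ≠ 1)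
    (hr : (W.baseChange K).mordellWeilRank = 1)
    {Ph : (W.baseChange K).toAffine.Point} (hPh : IsHeegnerPoint (W.conductorNorm ℤ) W K Ph)
    (hnt : ¬ IsOfFinAddOrder Ph)
    (hSha : AddCommGroup.primaryComponent (W.baseChange K).sha 2 = ⊥)
    (Dt : ModularParametrizationData W (W.conductorNorm ℤ)) (β : ℤ) (ι : K →+* ℂ)
    (d₁ : KolyvaginHeegnerData Dt β ι 1) {M₀ L : ℕ} (hM₀ : 1 ≤ M₀) (hML : M₀ ≤ L)
    (hdiv : ∃ Q : (W.baseChange (ringClassField K ι 1)).toAffine.Point,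
      ((2 ^ M₀ : ℕ) : ℤ) • Q = d₁.derivedPoint)
    {ℓ : ℕ} (hKol : Zhang2014.IsKolyvaginPrime (W.conductorNorm ℤ) W K 2 ℓ)
    (hidx : L ≤ Zhang2014.kolyvaginIndex W 2 ℓ) (e : KolyvaginHeegnerData Dt β ι ℓ) :
    ∃ Q : (W.baseChange (ringClassField K ι ℓ)).toAffine.Point, ((2 ^ (M₀ - 1) : ℕ) : ℤ) • Q = e.derivedPoint :=
  pow_dvd_derivedPoint_of_sha_primaryComponent_eq_bot W hρ2 hT hK hodd h3 hHe h37 τ hτ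
    (isOfFinAddOrder_map_sub_smul_of_mordellWeilRank_eq_one W hK hHe τ hτ hr hPh hnt) hSha Dt β ι d₁ hM₀ hML hdiv
    hKol hidx e

/-- **No deep prime-level witness of the crux on a trivial-`Ш` frame of depth `≥ 2`.**  Same frame, `ε`-line,
`Ш(E/K)[2^∞] = ⊥`, `2^{M₀} ∣ y_K` with `2 ≤ M₀ ≤ L`: for every Zhang–Kolyvagin prime `ℓ` at `2` of index `≥ L` and
every datum `e` of conductor `ℓ`, **`P_e(ℓ) ∈ 2E(K[ℓ])`** — so a witness `(n, d)` of `CMKolyvaginConjectureAtInertTwo`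
on such a frame is either composite or of index `< M₀`.  (Reading for the LINE-15 split: the deep prime-level form of
the crux forces `M₀ ≤ 1` in the R0 regime.) [cite: McCallumLMS1991, §5 (Prop. 5.2, Thm. 5.4)] -/
theorem two_dvd_derivedPoint_of_sha_eq_bot_of_two_le (hρ2 : W.HasSurjectiveModNGaloisRep 2)
    (hT : Odd W.tamagawaProduct)
    (hK : IsImaginaryQuadratic K) (hodd : Odd (NumberField.discr K)) (h3 : NumberField.discr K ≠ -3)
    (hHe : SatisfiesHeegnerHypothesis (W.conductorNorm ℤ) K)
    (h37 : prop37_2_reductionCongruence_inert (W.conductorNorm ℤ) W K) (τ : K ≃ₐ[ℚ] K) (hτ : τ ≠ 1)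
    (hline : ∀ x : (W.baseChange K).toAffine.Point,
      IsOfFinAddOrder (Affine.Point.map (W' := W) (τ : K →ₐ[ℚ] K) x - (-W.rootNumber) • x))
    (hSha : AddCommGroup.primaryComponent (W.baseChange K).sha 2 = ⊥)
    (Dt : ModularParametrizationData W (W.conductorNorm ℤ)) (β : ℤ) (ι : K →+* ℂ)
    (d₁ : KolyvaginHeegnerData Dt β ι 1) {M₀ L : ℕ} (hM₀ : 2 ≤ M₀) (hML : M₀ ≤ L)
    (hdiv : ∃ Q : (W.baseChange (ringClassField K ι 1)).toAffine.Point,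
      ((2 ^ M₀ : ℕ) : ℤ) • Q = d₁.derivedPoint)
    {ℓ : ℕ} (hKol : Zhang2014.IsKolyvaginPrime (W.conductorNorm ℤ) W K 2 ℓ)
    (hidx : L ≤ Zhang2014.kolyvaginIndex W 2 ℓ) (e : KolyvaginHeegnerData Dt β ι ℓ) :
    ∃ Q : (W.baseChange (ringClassField K ι ℓ)).toAffine.Point, (2 : ℤ) • Q = e.derivedPoint := by
  obtain ⟨Q, hQ⟩ := pow_dvd_derivedPoint_of_sha_primaryComponent_eq_bot W hρ2 hT hK hodd h3 hHe h37 τ hτ hline hSha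
    Dt β ι d₁ (by omega) hML hdiv hKol hidx e
  refine ⟨((2 ^ (M₀ - 2) : ℕ) : ℤ) • Q, ?_⟩
  rw [smul_smul, ← hQ, show (2 : ℤ) * ((2 ^ (M₀ - 2) : ℕ) : ℤ) = ((2 ^ (M₀ - 1) : ℕ) : ℤ) by
    rw [show M₀ - 1 = (M₀ - 2) + 1 by omega, pow_succ]; push_cast; ring]

end Summit.BirchSwinnertonDyer.BirchSwinnertonDyer.Theorems.CMKolyvaginFirstDescentTwo

end
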